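import Mathlib
import Literature.Barriers.Schanuel.NesterenkoModularScopeHolds
import Literature.Barriers.Schanuel.NesterenkoModularScopeValuesProofs
import Literature.Barriers.Schanuel.AlgebraicIndependenceOfLogarithms
import Literature.NumberTheory.Transcendental.OnePeriodsMasserCMProofs
import Literature.NumberTheory.EllipticCurves.SingularModuliIntegralCM
import Literature.NumberTheory.EllipticCurves.WeierstrassZetaLegendre
import Literature.NumberTheory.EllipticCurves.UniformizationProofs
import Literature.NumberTheory.EllipticCurves.LatticeJInvariant

/-!
# Line `sector-split` (v19) of crux `RigidCore.SchanuelOnLogFreeCore`: calibration C9 — Nesterenko's theorem at every imaginary-axis CM point: `π ⊥ e^{π√d}` for all `d ≥ 1`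

Crux `stmt-Schanuel-0970` (`Summit.Schanuel.Schanuel.Theses.RigidCore.SchanuelOnLogFreeCore`, (R):
Schanuel's conjecture for `ℚ`-free tuples from the log-free core `C_EA`), line `sector-split`,
skeleton v19 (lead c10).  This file proves the registered calibration stub

* `stub_nesterenkoImagAxis` — **for every natural number `d ≥ 1`, `π` and `e^{π√d}` are
  algebraically independent over `ℚ`** (Nesterenko 1996; LNM 1752 Ch. 1 Corollary 3.2 states the
  stronger independence of `π, e^{π√D}` and a Chowla–Selberg product of Γ-values).  The tree so far
  proved the two elliptic points only (`d = 1`: `nesterenko_holds`, `π, e^π, Γ(1/4)`; `d = 3`: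
  `nesterenko'_holds`, `π, e^{π√3}, Γ(1/3)`), through the explicit values of `E₂, E₄, E₆` at `i` and
  `ρ`.  Here NO explicit value is needed: we prove the period form
  `NesterenkoImagAxis.algebraicIndependent_pi_exp_period` — `π`, `e^{π√d}` and the period `ω` of ANY
  lattice `ω(ℤ i√d + ℤ)` with algebraic invariants `g₂, g₃` are algebraically independent — and such
  a normalisation exists because `j(i√d)` is algebraic.

## Proof (all inputs are theorems of the tree)

Let `τ = i√d`, `q = e^{2πiτ} = e^{−2π√d}`, `Λ_τ = ℤτ + ℤ`.
1. `Λ_τ` has complex multiplication by `τ` (`τ² = −d ∈ ℤ`), so `j(Λ_τ)` is an algebraic integer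
   (`Literature.NumberTheory.EllipticCurves.isIntegral_int_j_of_hasCM`, Cox Thm 11.1 / Silverman
   ATAEC II.6.1), hence `Λ_τ` is homothetic to a lattice `L = cΛ_τ` with ALGEBRAIC `g₂(L), g₃(L)`
   (`PeriodPair.exists_mulLeft_g₂_eq_g₃_eq`, with `(A, B) = (0, 1)`, `(1, 0)` or
   `A = B = 27j/(j − 1728)`).
2. Eisenstein's formula `ζ(z + b) − ζ(z) = bG₂(τ)/a² − 2πi/a` for an oriented basis `(a, b)`,
   `b/a = τ` (`PeriodPair.weierstrassZeta_add_snd_sub`) gives `η₁ω₁ = τ²G₂(τ) − 2πiτ` for every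
   period pair with `ω₁/ω₂ = τ` (`eta_mul_omega_eq`).
3. Masser's CM quasi-period relation (`MasserCM.cm_quasiPeriod_relation`, LNM 437 Lemma 3.1):
   `A η₁ω₁ − s ω₁² = K·2πi` with `A, s, K` algebraic, `A ≠ 0`.  With `τ² = −d`, `ω₁ = τω₂` this
   reads `G₂(τ) = (2π√d·A + s d ω₂² − 2πiK)/(dA)`, so `E₂(τ) = 3G₂(τ)/π² ∈ ℚ̄(π, ω₂)`.
4. `E₄(τ) = 3g₂(Λ_τ)/(4π⁴) = 3c⁴g₂(L)/(4π⁴)`, `E₆(τ) = 27c⁶g₃(L)/(8π⁶)` with `c = ω₂(L)`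
   (`PeriodPair.g₂_ofUpperHalfPlane`, `g₂_mulLeft`), and `P(q) = E₂(τ)`, `Q(q) = E₄(τ)`,
   `R(q) = E₆(τ)` (`ramanujanP_cexp`, …).  Hence `ℚ(q, P(q), Q(q), R(q)) ⊆ ℚ̄(q, π, ω₂)` and
   `q = (e^{π√d})^{−2}`.
5. Nesterenko's Theorem 1.1 (`nesterenko1996_thm_1_1_holds`, PROVED in the tree): the left side has
   transcendence degree `≥ 3`; so `π, e^{π√d}, ω₂` are algebraically independent.

## References

* [NesterenkoPhilippon2001] Yu. V. Nesterenko, P. Philippon (eds.), *Introduction to Algebraic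
  Independence Theory*, LNM 1752 (2001): Ch. 3 Theorem 1.1 (PDF p. 39); Ch. 1 §3 Corollary 3.2
  (PDF p. 19).
* [Masser1975] D. W. Masser, *Elliptic Functions and Transcendence*, LNM 437 (1975), Ch. III
  Lemma 3.1.
* [Cox2013] D. A. Cox, *Primes of the form x² + ny²*, 2nd ed. (2013), Thm. 11.1.
-/

noncomputable section

-- `Summit.Schanuel.Schanuel.…` is the D-0017 single-problem layout
set_option linter.dupNamespace false

namespace Summit.Schanuel.Schanuel.Theorems.RigidCore

open UpperHalfPlane hiding I
open Complex EisensteinSeries ModularForm IntermediateField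
open Literature.Barriers.Schanuel Literature.NumberTheory.Transcendental
open scoped Real

namespace NesterenkoImagAxis

/-! ## Step 1: complex multiplication and an algebraic normalisation -/

/-- The lattice `Λ_τ = ℤτ + ℤ` has complex multiplication by `τ` whenever `τ² ∈ ℤ`
(`τ(mτ + n) = nτ + mτ²`). [folklore] -/
theorem hasCM_ofUpperHalfPlane_of_sq (τ : ℍ) (m : ℤ) (hτ : (τ : ℂ) ^ 2 = m) :
    (PeriodPair.ofUpperHalfPlane τ).HasCM := by
  refine ⟨(τ : ℂ), fun n h => ?_, fun l hl => ?_⟩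
  · have him := congrArg Complex.im h
    simp only [UpperHalfPlane.coe_im, Complex.intCast_im] at him
    exact τ.im_pos.ne' him
  · obtain ⟨a, b, rfl⟩ := PeriodPair.mem_lattice.mp hl
    refine PeriodPair.mem_lattice.mpr ⟨b, a * m, ?_⟩
    simp only [PeriodPair.ofUpperHalfPlane_ω₁, PeriodPair.ofUpperHalfPlane_ω₂]
    push_cast
    linear_combination (-(a : ℂ)) * hτ

/-- Complex multiplication is preserved under homothety `Λ ↦ cΛ`. [folklore] -/
theorem hasCM_mulLeft {L : PeriodPair} (h : L.HasCM) (c : ℂ) (hc : c ≠ 0) :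
    (L.mulLeft c hc).HasCM := by
  obtain ⟨α, hαZ, hαΛ⟩ := h
  refine ⟨α, hαZ, fun l hl => ?_⟩
  rw [PeriodPair.mem_mulLeft_lattice] at hl ⊢
  have := hαΛ _ hl
  rwa [show c⁻¹ * (α * l) = α * (c⁻¹ * l) by ring]

/-- **An algebraic normalisation**: if `j(Λ)` is algebraic, `Λ` is homothetic to a lattice with
algebraic invariants `g₂, g₃` (rescale to `(g₂, g₃) = (0, 1)` if `g₂ = 0`, to `(1, 0)` if `g₃ = 0`,
and to `(g, g)` with `g = g₂³/g₃² = 27j/(j − 1728)` otherwise; Silverman AEC, proof of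
Cor. VI.5.1.1). [cite: SilvermanAEC2009, Cor VI.5.1.1 (proof)] -/
theorem exists_mulLeft_isAlgebraic (L : PeriodPair) (hj : IsAlgebraic ℚ L.j) :
    ∃ (c : ℂ) (hc : c ≠ 0), IsAlgebraic ℚ (L.mulLeft c hc).g₂ ∧ IsAlgebraic ℚ (L.mulLeft c hc).g₃ := by
  have hΔ : L.g₂ ^ 3 - 27 * L.g₃ ^ 2 ≠ 0 := L.discr_ne_zero
  by_cases h2 : L.g₂ = 0
  · -- rescale to `(0, 1)`
    obtain ⟨c, hc, h₂, h₃⟩ := L.exists_mulLeft_g₂_eq_g₃_eq (A := 0) (B := 1) (by norm_num)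
      (by rw [h2]; ring)
    exact ⟨c, hc, by rw [h₂]; exact isAlgebraic_zero, by rw [h₃]; exact isAlgebraic_one⟩
  by_cases h3 : L.g₃ = 0
  · -- rescale to `(1, 0)`
    obtain ⟨c, hc, h₂, h₃'⟩ := L.exists_mulLeft_g₂_eq_g₃_eq (A := 1) (B := 0) (by norm_num)
      (by rw [h3]; ring)
    exact ⟨c, hc, by rw [h₂]; exact isAlgebraic_one, by rw [h₃']; exact isAlgebraic_zero⟩
  · -- rescale to `(g, g)`, `g = g₂³/g₃² = 27 j/(j - 1728)`
    set g : ℂ := L.g₂ ^ 3 / L.g₃ ^ 2 with hg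
    have hg0 : g ≠ 0 := div_ne_zero (pow_ne_zero 3 h2) (pow_ne_zero 2 h3)
    have hg27 : g ≠ 27 := by
      intro h27
      apply hΔ
      rw [hg, div_eq_iff (pow_ne_zero 2 h3)] at h27
      linear_combination h27
    have hD : g ^ 3 - 27 * g ^ 2 ≠ 0 := by
      have : g ^ 3 - 27 * g ^ 2 = g ^ 2 * (g - 27) := by ring
      rw [this]
      exact mul_ne_zero (pow_ne_zero 2 hg0) (sub_ne_zero.mpr hg27)
    have hJ : L.g₂ ^ 3 * (g ^ 3 - 27 * g ^ 2) = g ^ 3 * (L.g₂ ^ 3 - 27 * L.g₃ ^ 2) := by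
      have hg' : g * L.g₃ ^ 2 = L.g₂ ^ 3 := by
        rw [hg, div_mul_cancel₀ _ (pow_ne_zero 2 h3)]
      linear_combination (27 * g ^ 2) * hg'
    obtain ⟨c, hc, h₂, h₃'⟩ := L.exists_mulLeft_g₂_eq_g₃_eq hD hJ
    -- `g` is algebraic: `g (j - 1728) = 27 j`, `j ≠ 1728`
    have hjΔ : L.j * (L.g₂ ^ 3 - 27 * L.g₃ ^ 2) = 1728 * L.g₂ ^ 3 := by
      rw [PeriodPair.j, div_mul_cancel₀ _ hΔ]
    have hj1728 : L.j ≠ 1728 := by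
      intro hj'
      apply h3
      rw [hj'] at hjΔ
      have : (1728 : ℂ) * 27 * L.g₃ ^ 2 = 0 := by linear_combination -hjΔ
      simpa using this
    have hg' : g * L.g₃ ^ 2 = L.g₂ ^ 3 := by
      rw [hg, div_mul_cancel₀ _ (pow_ne_zero 2 h3)]
    have hgj : g = 27 * L.j / (L.j - 1728) := by
      have key : (g * (L.j - 1728) - 27 * L.j) * (L.g₃ ^ 2 * (L.g₂ ^ 3 - 27 * L.g₃ ^ 2)) = 0 := by
        linear_combination ((L.g₂ ^ 3 - 27 * L.g₃ ^ 2) * (L.j - 1728)) * hg' +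
          (L.g₂ ^ 3 - 27 * L.g₃ ^ 2) * hjΔ
      have h0 : g * (L.j - 1728) - 27 * L.j = 0 :=
        (mul_eq_zero.mp key).resolve_right (mul_ne_zero (pow_ne_zero 2 h3) hΔ)
      rw [eq_div_iff (sub_ne_zero.mpr hj1728)]
      linear_combination h0
    have h27 : IsAlgebraic ℚ (27 : ℂ) := by
      simpa using isAlgebraic_nat (R := ℚ) (A := ℂ) 27
    have h1728 : IsAlgebraic ℚ (1728 : ℂ) := by
      simpa using isAlgebraic_nat (R := ℚ) (A := ℂ) 1728
    have hgalg : IsAlgebraic ℚ g := by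
      rw [hgj, div_eq_mul_inv]
      exact (h27.mul hj).mul (hj.sub h1728).inv
    exact ⟨c, hc, by rw [h₂]; exact hgalg, by rw [h₃']; exact hgalg⟩

/-! ## Step 2: `η₁ω₁ = τ²G₂(τ) − 2πiτ` -/

/-- **Eisenstein's formula for the quasi-period, scale-free form**: for a period pair with
`ω₁ = τω₂`, `τ ∈ ℍ`, one has `η₁ω₁ = τ²G₂(τ) − 2πiτ` (from `ζ(z + b) − ζ(z) = bG₂(τ)/a² − 2πi/a`
for the oriented basis `(a, b) = (ω₂, ω₁)`, tree `PeriodPair.weierstrassZeta_add_snd_sub`).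
[folklore] -/
theorem eta_mul_omega_eq (L : PeriodPair) (τ : ℍ) (hω : L.ω₁ = (τ : ℂ) * L.ω₂) :
    L.η₁ * L.ω₁ = (τ : ℂ) ^ 2 * G2 τ - 2 * π * I * τ := by
  have hω₂ : L.ω₂ ≠ 0 := by simpa using L.indep.ne_zero 1
  have hdiv : L.ω₁ / L.ω₂ = τ := by rw [hω, mul_div_cancel_right₀ _ hω₂]
  have h : 0 < (L.ω₁ / L.ω₂).im := by rw [hdiv]; exact τ.im_pos
  have hτ : (⟨L.ω₁ / L.ω₂, h⟩ : ℍ) = τ := UpperHalfPlane.ext hdiv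
  have key := PeriodPair.weierstrassZeta_add_snd_sub
    ((Equiv.prodComm ℤ ℤ).trans L.latticeEquivProd.symm.toEquiv)
    L.coe_prodComm_latticeEquivProd_symm h 0
  rw [zero_add, hτ] at key
  have hη : L.weierstrassZeta L.ω₁ - L.weierstrassZeta 0 = L.η₁ := by
    have := L.weierstrassZeta_add_ω₁_eq 0
    rw [zero_add] at this
    rw [this]; ring
  rw [hη] at key
  rw [key, hω]
  field_simp

/-! ## Steps 3–5: the period form of Nesterenko's corollary at `τ = i√d` -/

/-- **Nesterenko's corollary at `τ = i√d`, period form** (PROVED): let `d ≥ 1`, `τ = i√d`, and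
let `L` be any period pair spanning a lattice `cΛ_τ` (`ω₁ = τω₂`) with complex multiplication and
ALGEBRAIC invariants `g₂(L), g₃(L)`.  Then `π`, `e^{π√d}` and the period `ω₂(L)` are algebraically
independent over `ℚ`: by Masser's CM relation and Eisenstein's formula `E₂(τ) ∈ ℚ̄(π, ω₂)`, while
`E₄(τ), E₆(τ) ∈ ℚ̄·(ω₂/π)^{4,6}`, so `ℚ(q, P(q), Q(q), R(q)) ⊆ ℚ̄(q, π, ω₂)` for `q = e^{−2π√d}`,
and Nesterenko's Theorem 1.1 gives transcendence degree `3`.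
[cite: NesterenkoPhilippon2001, Ch. 1 §3 Corollary 3.2 (PDF p. 19); Ch. 3 Theorem 1.1 (PDF p. 39)]
[cite: Masser1975, Ch. III Lemma 3.1] -/
theorem algebraicIndependent_pi_exp_period (d : ℕ) (hd : d ≠ 0) (τ : ℍ)
    (hτ : (τ : ℂ) = I * (Real.sqrt d : ℝ)) (c : ℂ) (hc : c ≠ 0)
    (h₂ : IsAlgebraic ℚ ((PeriodPair.ofUpperHalfPlane τ).mulLeft c hc).g₂)
    (h₃ : IsAlgebraic ℚ ((PeriodPair.ofUpperHalfPlane τ).mulLeft c hc).g₃) :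
    AlgebraicIndependent ℚ
      ![(Real.pi : ℂ), Complex.exp ((Real.pi * Real.sqrt d : ℝ) : ℂ), c] := by
  set s : ℝ := Real.sqrt d with hs
  have hs2 : ((s : ℝ) : ℂ) ^ 2 = (d : ℂ) := by
    rw [← Complex.ofReal_pow, hs, Real.sq_sqrt (Nat.cast_nonneg d)]; simp
  have hτ2 : (τ : ℂ) ^ 2 = -(d : ℂ) := by rw [hτ, mul_pow, Complex.I_sq, hs2]; ring
  have hdC : (d : ℂ) ≠ 0 := by exact_mod_cast hd
  have hπ : (π : ℂ) ≠ 0 := by exact_mod_cast Real.pi_ne_zero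
  set L₀ := PeriodPair.ofUpperHalfPlane τ with hL₀
  set L := L₀.mulLeft c hc with hLdef
  have hω₁ : L.ω₁ = c * τ := by rw [hLdef, PeriodPair.mulLeft_ω₁, hL₀, PeriodPair.ofUpperHalfPlane_ω₁]
  have hω₂ : L.ω₂ = c := by rw [hLdef, PeriodPair.mulLeft_ω₂, hL₀, PeriodPair.ofUpperHalfPlane_ω₂, mul_one]
  have hω : L.ω₁ = (τ : ℂ) * L.ω₂ := by rw [hω₁, hω₂, mul_comm]
  -- CM and Masser's relation `A η₁ω₁ − s_M ω₁² = K·2πi`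
  have hCM₀ : L₀.HasCM := hasCM_ofUpperHalfPlane_of_sq τ (-(d : ℤ)) (by rw [hτ2]; push_cast; ring)
  have hCM : L.HasCM := hasCM_mulLeft hCM₀ c hc
  obtain ⟨A, sM, K, hA, hsM, hK, hA0, -, hrel⟩ := MasserCM.cm_quasiPeriod_relation L h₂ h₃ hCM
  -- Eisenstein: `η₁ω₁ = τ²G₂(τ) − 2πiτ`, hence `G₂(τ) = (2π√d A + s_M c² d − 2πiK)/(dA)`
  have hηω := eta_mul_omega_eq L τ hω
  have hG2 : G2 τ = (2 * π * s * A + sM * c ^ 2 * d - 2 * π * I * K) / (d * A) := by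
    rw [eq_div_iff (mul_ne_zero hdC hA0)]
    have h1 : A * (L.η₁ * L.ω₁) - sM * L.ω₁ ^ 2 = K * (2 * π * I) := by rw [← hrel]; ring
    rw [hηω, hω₁, mul_pow, hτ2] at h1
    rw [hτ] at h1
    have hI3 : (2 : ℂ) * π * I * (I * s) = -(2 * π * s) := by
      have : (I : ℂ) * I = -1 := Complex.I_mul_I
      linear_combination (2 * π * s : ℂ) * this
    rw [hI3] at h1
    linear_combination -h1
  -- the nome and the Eisenstein values
  set q : ℂ := cexp (2 * π * I * τ) with hq
  have hE : cexp (((π * s : ℝ)) : ℂ) ^ 2 = cexp (2 * π * s) := by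
    rw [← Complex.exp_nat_mul]; push_cast; ring_nf
  have hqE : q = (cexp (((π * s : ℝ)) : ℂ) ^ 2)⁻¹ := by
    rw [hE, hq, hτ, ← Complex.exp_neg]
    congr 1
    have : (I : ℂ) * I = -1 := Complex.I_mul_I
    linear_combination (2 * π * s : ℂ) * this
  have hq0 : 0 < ‖q‖ := by rw [hq]; exact norm_pos_iff.mpr (Complex.exp_ne_zero _)
  have hq1 : ‖q‖ < 1 := by
    rw [hqE, hE, norm_inv, Complex.norm_exp]
    have hre : (2 * (π : ℂ) * s).re = 2 * π * s := by simp
    rw [hre]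
    have hpos : 0 < 2 * π * s :=
      mul_pos (mul_pos two_pos Real.pi_pos) (Real.sqrt_pos.mpr (by exact_mod_cast Nat.pos_of_ne_zero hd))
    exact inv_lt_one_of_one_lt₀ (Real.one_lt_exp_iff.mpr hpos)
  have hP : ramanujanP q = E2 τ := ramanujanP_cexp τ
  have hQ : ramanujanQ q = E₄ τ := ramanujanQ_cexp τ
  have hR : ramanujanR q = E₆ τ := ramanujanR_cexp τ
  have hE2 : E2 τ = (1 / (2 * riemannZeta 2)) * G2 τ := by
    simp only [E2, Pi.smul_apply, smul_eq_mul]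
  have hζ : riemannZeta 2 = (π : ℂ) ^ 2 / 6 := by
    have h := riemannZeta_two
    simpa using h
  have hE4 : E₄ τ = 3 * c ^ 4 * L.g₂ / (4 * (π : ℂ) ^ 4) := by
    have h0 : L₀.g₂ = (4 * (π : ℂ) ^ 4 / 3) * E₄ τ := PeriodPair.g₂_ofUpperHalfPlane τ
    have hL2 : L.g₂ = (c ^ 4)⁻¹ * L₀.g₂ := PeriodPair.g₂_mulLeft c hc L₀
    rw [hL2, h0]
    field_simp
  have hE6 : E₆ τ = 27 * c ^ 6 * L.g₃ / (8 * (π : ℂ) ^ 6) := by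
    have h0 : L₀.g₃ = (8 * (π : ℂ) ^ 6 / 27) * E₆ τ := PeriodPair.g₃_ofUpperHalfPlane τ
    have hL3 : L.g₃ = (c ^ 6)⁻¹ * L₀.g₃ := PeriodPair.g₃_mulLeft c hc L₀
    rw [hL3, h0]
    field_simp
  -- Nesterenko's Theorem 1.1
  have h3 := nesterenko1996_thm_1_1_holds q hq0 hq1
  -- the field `ℚ(q, P, Q, R)` lies in `ℚ(S ∪ T)`, `S = {π, e^{π√d}, c}`, `T` algebraic
  set l : Fin 3 → ℂ := ![(Real.pi : ℂ), Complex.exp ((Real.pi * s : ℝ) : ℂ), c] with hldef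
  set S : Set ℂ := Set.range l with hSdef
  set T : Set ℂ := {((s : ℝ) : ℂ), I, A, sM, K, L.g₂, L.g₃} with hTdef
  have hpi : (Real.pi : ℂ) ∈ adjoin ℚ (S ∪ T) := subset_adjoin ℚ _ (Or.inl ⟨0, by simp [hldef]⟩)
  have hexp : Complex.exp ((Real.pi * s : ℝ) : ℂ) ∈ adjoin ℚ (S ∪ T) :=
    subset_adjoin ℚ _ (Or.inl ⟨1, by simp [hldef]⟩)
  have hcm : c ∈ adjoin ℚ (S ∪ T) := subset_adjoin ℚ _ (Or.inl ⟨2, by simp [hldef]⟩)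
  have hsm : ((s : ℝ) : ℂ) ∈ adjoin ℚ (S ∪ T) := subset_adjoin ℚ _ (Or.inr (by simp [hTdef]))
  have hIm : (I : ℂ) ∈ adjoin ℚ (S ∪ T) := subset_adjoin ℚ _ (Or.inr (by simp [hTdef]))
  have hAm : A ∈ adjoin ℚ (S ∪ T) := subset_adjoin ℚ _ (Or.inr (by simp [hTdef]))
  have hsMm : sM ∈ adjoin ℚ (S ∪ T) := subset_adjoin ℚ _ (Or.inr (by simp [hTdef]))
  have hKm : K ∈ adjoin ℚ (S ∪ T) := subset_adjoin ℚ _ (Or.inr (by simp [hTdef]))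
  have hg2m : L.g₂ ∈ adjoin ℚ (S ∪ T) := subset_adjoin ℚ _ (Or.inr (by simp [hTdef]))
  have hg3m : L.g₃ ∈ adjoin ℚ (S ∪ T) := subset_adjoin ℚ _ (Or.inr (by simp [hTdef]))
  have hdm : (d : ℂ) ∈ adjoin ℚ (S ∪ T) := IntermediateField.natCast_mem _ d
  have hle : adjoin ℚ ({q, ramanujanP q, ramanujanQ q, ramanujanR q} : Set ℂ) ≤ adjoin ℚ (S ∪ T) := by
    rw [adjoin_le_iff]
    rintro w hw
    simp only [Set.mem_insert_iff, Set.mem_singleton_iff] at hw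
    rcases hw with rfl | rfl | rfl | rfl
    · rw [hqE]
      exact inv_mem (pow_mem hexp 2)
    · rw [hP, hE2, hζ, hG2]
      refine mul_mem (div_mem (one_mem _) (mul_mem (ofNat_mem _ 2)
        (div_mem (pow_mem hpi 2) (ofNat_mem _ 6)))) (div_mem ?_ (mul_mem hdm hAm))
      refine sub_mem (add_mem ?_ ?_) ?_
      · exact mul_mem (mul_mem (mul_mem (ofNat_mem _ 2) hpi) hsm) hAm
      · exact mul_mem (mul_mem hsMm (pow_mem hcm 2)) hdm
      · exact mul_mem (mul_mem (mul_mem (ofNat_mem _ 2) hpi) hIm) hKm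
    · rw [hQ, hE4]
      exact div_mem (mul_mem (mul_mem (ofNat_mem _ 3) (pow_mem hcm 4)) hg2m)
        (mul_mem (ofNat_mem _ 4) (pow_mem hpi 4))
    · rw [hR, hE6]
      exact div_mem (mul_mem (mul_mem (ofNat_mem _ 27) (pow_mem hcm 6)) hg3m)
        (mul_mem (ofNat_mem _ 8) (pow_mem hpi 6))
  have h3' : ((3 : ℕ) : Cardinal) ≤ Algebra.trdeg ℚ (adjoin ℚ (S ∪ T)) := by
    exact_mod_cast h3.trans (trdeg_le_of_injective (IntermediateField.inclusion hle)
      (IntermediateField.inclusion_injective hle))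
  have hT : ∀ y ∈ T, IsAlgebraic ℚ y := by
    intro y hy
    simp only [hTdef, Set.mem_insert_iff, Set.mem_singleton_iff] at hy
    rcases hy with rfl | rfl | rfl | rfl | rfl | rfl | rfl
    · -- `√d` is a root of `X² − d`
      refine ⟨Polynomial.X ^ 2 - Polynomial.C (d : ℚ), ?_, ?_⟩
      · exact Polynomial.X_pow_sub_C_ne_zero (by norm_num) _
      · simp [hs2]
    · exact ⟨Polynomial.X ^ 2 + 1, Polynomial.X_pow_add_C_ne_zero (by norm_num) 1, by simp⟩
    · exact hA
    · exact hsM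
    · exact hK
    · exact h₂
    · exact h₃
  have h3'' : ((3 : ℕ) : Cardinal) ≤ Algebra.trdeg ℚ (adjoin ℚ S) :=
    h3'.trans_eq (trdeg_adjoin_union_eq_of_isAlgebraic S T hT)
  exact algebraicIndependent_of_le_trdeg_adjoin l h3''

end NesterenkoImagAxis

open NesterenkoImagAxis in
/-- **Stub `stub_nesterenkoImagAxis` of line `sector-split` (v19, calibration C9; registered
signature)**: for every `d ≥ 1`, `π` and `e^{π√d}` are algebraically independent over `ℚ`
(Nesterenko 1996 at the CM point `τ = i√d`).  From the period form
`NesterenkoImagAxis.algebraicIndependent_pi_exp_period` at an algebraic normalisation `cΛ_{i√d}` of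
the CM lattice, which exists because `j(i√d)` is an algebraic integer
(`isIntegral_int_j_of_hasCM`).
[cite: NesterenkoPhilippon2001, Ch. 1 §3 Corollary 3.2 (PDF p. 19); Ch. 3 Theorem 1.1 (PDF p. 39)] -/
theorem stub_nesterenkoImagAxis :
    ∀ d : ℕ, d ≠ 0 →
      AlgebraicIndependent ℚ ![(Real.pi : ℂ), Complex.exp ((Real.pi * Real.sqrt d : ℝ) : ℂ)] := by
  intro d hd
  have hs0 : 0 < Real.sqrt d := Real.sqrt_pos.mpr (by exact_mod_cast Nat.pos_of_ne_zero hd)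
  let τ : ℍ := ⟨I * (Real.sqrt d : ℝ), by simpa using hs0⟩
  have hτ : (τ : ℂ) = I * (Real.sqrt d : ℝ) := rfl
  have hs2 : (((Real.sqrt d : ℝ)) : ℂ) ^ 2 = (d : ℂ) := by
    rw [← Complex.ofReal_pow, Real.sq_sqrt (Nat.cast_nonneg d)]; simp
  have hτ2 : (τ : ℂ) ^ 2 = ((-(d : ℤ) : ℤ) : ℂ) := by
    rw [hτ, mul_pow, Complex.I_sq, hs2]; push_cast; ring
  have hCM₀ := hasCM_ofUpperHalfPlane_of_sq τ _ hτ2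
  have hj : IsAlgebraic ℚ (PeriodPair.ofUpperHalfPlane τ).j :=
    ((Literature.NumberTheory.EllipticCurves.isIntegral_int_j_of_hasCM hCM₀).tower_top
      (A := ℚ)).isAlgebraic
  obtain ⟨c, hc, h₂, h₃⟩ := exists_mulLeft_isAlgebraic _ hj
  have h := algebraicIndependent_pi_exp_period d hd τ hτ c hc h₂ h₃
  have h' := h.comp ![(0 : Fin 3), 1] (by decide)
  convert h' using 1
  funext i; fin_cases i <;> rfl

/-- **Nesterenko's corollary on the imaginary axis, real form**: for every `d ≥ 1` the real numbers
`π` and `e^{π√d}` are algebraically independent over `ℚ` (the statement in the style of the tree's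
`Literature.NumberTheory.Transcendental.nesterenko` / `nesterenko'`, which are the cases `d = 1, 3`
with the Γ-value adjoined).
[cite: NesterenkoPhilippon2001, Ch. 1 §3 Corollary 3.2 (PDF p. 19)] -/
theorem NesterenkoImagAxis.algebraicIndependent_pi_exp_pi_mul_sqrt (d : ℕ) (hd : d ≠ 0) :
    AlgebraicIndependent ℚ ![Real.pi, Real.exp (Real.pi * Real.sqrt d)] := by
  refine algebraicIndependent_real_of_complex _ ?_
  have h := stub_nesterenkoImagAxis d hd
  convert h using 1
  funext i; fin_cases i <;> simp [Complex.ofReal_exp]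

/-- Example cell input: `π ⊥ e^{π√2}` (`d = 2`), new in the tree. [cite: NesterenkoPhilippon2001, Ch. 1 §3 Corollary 3.2 (PDF p. 19)] -/
theorem NesterenkoImagAxis.algebraicIndependent_pi_exp_pi_mul_sqrt_two :
    AlgebraicIndependent ℚ ![Real.pi, Real.exp (Real.pi * Real.sqrt 2)] :=
  NesterenkoImagAxis.algebraicIndependent_pi_exp_pi_mul_sqrt 2 two_ne_zero

end Summit.Schanuel.Schanuel.Theorems.RigidCore

end
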